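import Mathlib
import HarnessLib
import Literature.MathematicalPhysics.QuantumLattice.GaugeGroups
import Literature.MathematicalPhysics.QuantumFieldTheory.ConstructiveQFTWave0
import Literature.MathematicalPhysics.QuantumFieldTheory.UnitaryCayleyChart
import Summits.Ventures.LatticeQCDFlow.Scaling.Conjectures
import Summits.Ventures.LatticeQCDFlow.Scaling.LatticeEntropySUN
import Summits.Ventures.LatticeQCDFlow.Scaling.LatticeEntropySUNHaarVolume
import Summits.Ventures.LatticeQCDFlow.Scaling.ExactTransportVolume
import Summits.Ventures.LatticeQCDFlow.Scaling.ExactTransportUN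

/-!
# LatticeQCDFlow / Scaling — (C2a) for `SU(N)` with the Hilbert–Schmidt metric: exact transport is `e^{cβ}`-bi-Lipschitz

HONEST FRAMING: exact (Metropolis-corrected) sampling algorithms for lattice gauge theory; figures of merit are
autocorrelation/cost numbers at stated couplings and volumes; no continuum-physics claim.

Venture `LatticeQCDFlow` (cell pub-lqcd), topic `Scaling`, FANOUT row 30 (lean-1) — OUR WORK.  The instance `G = SU(N)`
(`N ≥ 2`), fundamental representation, `d ≥ 2`, Hilbert–Schmidt metric, of the conjecture item
`Conjectures.ExactTransportBiLipschitz` ((C2a), THEORY-2.md §3.3): `SUN.exactTransportBiLipschitz` — every exact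
bi-Lipschitz transport of `Haar^{⊗E}` onto the Wilson law has `Lip·coLip ≥ exp(β/(2(N²-1)d))` for `β ≥ 4d·log(A/a)`
(`SU(3)`, `d = 4`: `≥ e^{β/64}`), uniformly in `L`.  It is `exactTransportBiLipschitz_of_ballVolumes` fed with

* (V) Hilbert–Schmidt ball volumes `≍ r^{N²-1}` about every centre: balls are left translates of the ball about `1`,
  which is the action ball `{N - Re tr V ≤ (r/√2)²}` (`SUNHaar.actionBall_eq`), whose volume is
  `Scaling/LatticeEntropySUNHaarVolume.lean`;
* (S) the extensive configuration `a = XZ` on direction-`0` links, `b = D = diag(i, -i, 1, …, 1)` on direction-`1`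
  links (both in `SU(N)`): `a b a⁻¹ b⁻¹ = X D X D⁻¹ = diag(-1,-1,1,…,1)`, plaquette action `4`, `S ≥ 4·L^d`.

Elementary given the tree; nothing here is cited as a fact.
-/

noncomputable section

open scoped Matrix.Norms.Frobenius
open MeasureTheory Metric Set
open Literature.MathematicalPhysics.QuantumFieldTheory
open Literature.MathematicalPhysics.QuantumLattice (fundamentalRep fundamentalRep_apply continuous_fundamentalRep)

namespace Summit.Ventures.LatticeQCDFlow.Theory2.Lattice.SUN

variable {N : ℕ}

/-! ## §1. Hilbert–Schmidt balls in `SU(N)` and their Haar volume -/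

/-- Balls of the Hilbert–Schmidt metric on `SU(N)` are Frobenius-norm balls. [folklore] -/
theorem closedBall_eq (g : Matrix.specialUnitaryGroup (Fin N) ℂ) (r : ℝ) :
    closedBall g r = {U : Matrix.specialUnitaryGroup (Fin N) ℂ | ‖(U : Matrix (Fin N) (Fin N) ℂ) - g‖ ≤ r} := by
  ext U
  rw [mem_closedBall, Subtype.dist_eq, dist_eq_norm]
  rfl

/-- Balls about `g` are left translates of the ball about `1`. [folklore] -/
theorem closedBall_eq_preimage (g : Matrix.specialUnitaryGroup (Fin N) ℂ) (r : ℝ) :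
    closedBall g r = (fun U => g⁻¹ * U) ⁻¹'
      {U : Matrix.specialUnitaryGroup (Fin N) ℂ | ‖(U : Matrix (Fin N) (Fin N) ℂ) - 1‖ ≤ r} := by
  rw [closedBall_eq]
  ext U
  simp only [mem_setOf_eq, mem_preimage]
  have hg : (g : Matrix (Fin N) (Fin N) ℂ) ∈ Matrix.unitaryGroup (Fin N) ℂ :=
    (Matrix.mem_specialUnitaryGroup_iff.mp g.2).1
  have hgg : star (g : Matrix (Fin N) (Fin N) ℂ) * g = 1 := Matrix.mem_unitaryGroup_iff'.mp hg
  have hsg : star (g : Matrix (Fin N) (Fin N) ℂ) ∈ Matrix.unitaryGroup (Fin N) ℂ := by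
    rw [Matrix.mem_unitaryGroup_iff, star_star]; exact hgg
  have e : ((g⁻¹ * U : Matrix.specialUnitaryGroup (Fin N) ℂ) : Matrix (Fin N) (Fin N) ℂ) - 1 =
      ((⟨star (g : Matrix (Fin N) (Fin N) ℂ), hsg⟩ : Matrix.unitaryGroup (Fin N) ℂ) : Matrix (Fin N) (Fin N) ℂ) *
        ((U : Matrix (Fin N) (Fin N) ℂ) - g) := by
    show star (g : Matrix (Fin N) (Fin N) ℂ) * (U : Matrix (Fin N) (Fin N) ℂ) - 1 =
      star (g : Matrix (Fin N) (Fin N) ℂ) * ((U : Matrix (Fin N) (Fin N) ℂ) - g)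
    rw [Matrix.mul_sub, hgg]
  rw [e, Matrix.frobenius_norm_unitaryGroup_mul]

/-- Haar volume of a ball about any centre is that of the ball about `1`. [folklore] -/
theorem haar_closedBall (g : Matrix.specialUnitaryGroup (Fin N) ℂ) (r : ℝ) :
    haarProbability (Matrix.specialUnitaryGroup (Fin N) ℂ) (closedBall g r) =
      haarProbability (Matrix.specialUnitaryGroup (Fin N) ℂ)
        {U : Matrix.specialUnitaryGroup (Fin N) ℂ | ‖(U : Matrix (Fin N) (Fin N) ℂ) - 1‖ ≤ r} := by
  rw [closedBall_eq_preimage, measure_preimage_mul]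

/-- The Hilbert–Schmidt ball about `1` of radius `r ≥ 0` is the action ball of radius `r/√2`. [folklore] -/
theorem hsBall_eq_actionBall [NeZero N] {r : ℝ} (hr : 0 ≤ r) :
    {U : Matrix.specialUnitaryGroup (Fin N) ℂ | ‖(U : Matrix (Fin N) (Fin N) ℂ) - 1‖ ≤ r} =
      {U : Matrix.specialUnitaryGroup (Fin N) ℂ | (N : ℝ) - (fundamentalRep (Fin N) U).trace.re ≤ (r / Real.sqrt 2) ^ 2} := by
  rw [SUNHaar.actionBall_eq (by positivity : 0 ≤ r / Real.sqrt 2)]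
  have h : Real.sqrt 2 * (r / Real.sqrt 2) = r := by field_simp
  rw [h]

/-- (V), lower half, for `SU(N)`: `a'·r^{N²-1} ≤ Haar(B̄(g,r))`, `0 < r ≤ 1`. [folklore] -/
theorem haar_closedBall_ge [NeZero N] : ∃ a : ℝ, 0 < a ∧ ∀ (g : Matrix.specialUnitaryGroup (Fin N) ℂ) (r : ℝ),
    0 < r → r ≤ 1 →
      a * r ^ (N * N - 1) ≤ (haarProbability (Matrix.specialUnitaryGroup (Fin N) ℂ) (closedBall g r)).toReal := by
  obtain ⟨a, ha, h⟩ := SUNHaar.haar_actionBall_ge (N := N)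
  have hs : 0 < Real.sqrt 2 := by positivity
  have hs1 : 1 ≤ Real.sqrt 2 := Real.one_le_sqrt.2 (by norm_num)
  refine ⟨a * (1 / Real.sqrt 2) ^ (N * N - 1), by positivity, fun g r hr hr1 => ?_⟩
  rw [haar_closedBall, hsBall_eq_actionBall hr.le]
  have hr' : 0 < r / Real.sqrt 2 := by positivity
  have hr1' : r / Real.sqrt 2 ≤ 1 := by
    rw [div_le_one hs]; exact hr1.trans hs1
  have h1 := h (r / Real.sqrt 2) hr' hr1'
  rw [SUNHaar.rpow_sq_sub_one] at h1
  calc a * (1 / Real.sqrt 2) ^ (N * N - 1) * r ^ (N * N - 1) = a * (r / Real.sqrt 2) ^ (N * N - 1) := by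
        rw [mul_assoc, ← mul_pow]; congr 2; field_simp
    _ ≤ _ := h1

/-- (V), upper half, for `SU(N)`: `Haar(B̄(g,r)) ≤ A'·r^{N²-1}`, `0 < r`. [folklore] -/
theorem haar_closedBall_le [NeZero N] : ∃ A : ℝ, 0 < A ∧ ∀ (g : Matrix.specialUnitaryGroup (Fin N) ℂ) (r : ℝ),
    0 < r → (haarProbability (Matrix.specialUnitaryGroup (Fin N) ℂ) (closedBall g r)).toReal ≤ A * r ^ (N * N - 1) := by
  obtain ⟨A, h⟩ := SUNHaar.haar_actionBall_le (N := N)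
  have hs : 0 < Real.sqrt 2 := by positivity
  have hA0 : 0 ≤ A := by
    have h1 := h 1 one_pos
    rw [Real.one_rpow, mul_one] at h1
    exact le_trans ENNReal.toReal_nonneg h1
  refine ⟨(A + 1) * (1 / Real.sqrt 2) ^ (N * N - 1), by positivity, fun g r hr => ?_⟩
  rw [haar_closedBall, hsBall_eq_actionBall hr.le]
  have hr' : 0 < r / Real.sqrt 2 := by positivity
  have h1 := h (r / Real.sqrt 2) hr'
  rw [SUNHaar.rpow_sq_sub_one] at h1
  calc _ ≤ A * (r / Real.sqrt 2) ^ (N * N - 1) := h1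
    _ ≤ (A + 1) * (r / Real.sqrt 2) ^ (N * N - 1) := by
        have : 0 ≤ (r / Real.sqrt 2) ^ (N * N - 1) := by positivity
        nlinarith
    _ = (A + 1) * (1 / Real.sqrt 2) ^ (N * N - 1) * r ^ (N * N - 1) := by
        rw [mul_assoc, ← mul_pow]; congr 2; field_simp

/-- `-N ≤ Re tr U` on `SU(N)`. [folklore] -/
theorem neg_le_re_trace (U : Matrix.specialUnitaryGroup (Fin N) ℂ) : -(N : ℝ) ≤ (fundamentalRep (Fin N) U).trace.re := by
  have hU : (U : Matrix (Fin N) (Fin N) ℂ) ∈ Matrix.unitaryGroup (Fin N) ℂ :=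
    (Matrix.mem_specialUnitaryGroup_iff.mp U.2).1
  have h := UN.neg_le_re_trace (⟨U, hU⟩ : Matrix.unitaryGroup (Fin N) ℂ)
  rw [Literature.MathematicalPhysics.QuantumLattice.unitaryFundamentalRep_apply] at h
  rw [fundamentalRep_apply]
  exact h

/-! ## §2. Two elements of `SU(N)` with a commutator of action `4`: `a = XZ`, `b = D = diag(i,-i,1,…,1)` -/

section Pair

variable (i₀ i₁ : Fin N)

/-- The phase vector `(i at i₀, -i at i₁, 1 elsewhere)`. [folklore] -/
def phaseV : Fin N → ℂ := fun i => (if i = i₀ then Complex.I else 1) * (if i = i₁ then -Complex.I else 1)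

/-- `D = diag(i at i₀, -i at i₁, 1 elsewhere)`. [folklore] -/
def phaseM : Matrix (Fin N) (Fin N) ℂ := Matrix.diagonal (phaseV i₀ i₁)

/-- Entries of the phase vector have unit modulus: `d̄·d = 1`. [folklore] -/
theorem star_phaseV_mul (i : Fin N) : star (phaseV i₀ i₁ i) * phaseV i₀ i₁ i = 1 := by
  simp only [phaseV]
  split_ifs <;> simp

/-- `Dᴴ D = 1`: `D ∈ U(N)`. [folklore] -/
theorem phaseM_mem_unitary : phaseM i₀ i₁ ∈ Matrix.unitaryGroup (Fin N) ℂ := by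
  rw [Matrix.mem_unitaryGroup_iff', Matrix.star_eq_conjTranspose, phaseM, Matrix.diagonal_conjTranspose,
    Matrix.diagonal_mul_diagonal, ← Matrix.diagonal_one]
  congr 1
  funext i
  exact star_phaseV_mul i₀ i₁ i

/-- `det D = 1`. [folklore] -/
theorem det_phaseM : (phaseM i₀ i₁).det = 1 := by
  rw [phaseM, Matrix.det_diagonal]
  simp only [phaseV]
  rw [Finset.prod_mul_distrib, Finset.prod_ite_eq' Finset.univ i₀, Finset.prod_ite_eq' Finset.univ i₁]
  simp

/-- `D ∈ SU(N)`. [folklore] -/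
theorem phaseM_mem : phaseM i₀ i₁ ∈ Matrix.specialUnitaryGroup (Fin N) ℂ :=
  Matrix.mem_specialUnitaryGroup_iff.mpr ⟨phaseM_mem_unitary i₀ i₁, det_phaseM i₀ i₁⟩

/-- `det X = -1` (a transposition). [folklore] -/
theorem det_swapM (h01 : i₀ ≠ i₁) : (UN.swapM i₀ i₁).det = -1 := by
  rw [UN.swapM, Matrix.det_permutation, Equiv.Perm.sign_swap h01]
  simp

/-- `det Z = -1`. [folklore] -/
theorem det_signM : (UN.signM i₀ : Matrix (Fin N) (Fin N) ℂ).det = -1 := by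
  rw [UN.signM, Matrix.det_diagonal]
  simp only [UN.signV]
  rw [Finset.prod_ite_eq' Finset.univ i₀]
  simp

/-- `a = XZ ∈ SU(N)`. [folklore] -/
theorem swapM_mul_signM_mem (h01 : i₀ ≠ i₁) :
    UN.swapM i₀ i₁ * UN.signM i₀ ∈ Matrix.specialUnitaryGroup (Fin N) ℂ := by
  rw [Matrix.mem_specialUnitaryGroup_iff]
  refine ⟨Submonoid.mul_mem _ (UN.swapM_mem i₀ i₁) (UN.signM_mem i₀), ?_⟩
  rw [Matrix.det_mul, det_swapM i₀ i₁ h01, det_signM]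
  norm_num

/-- The two group elements. [folklore] -/
def gA (h01 : i₀ ≠ i₁) : Matrix.specialUnitaryGroup (Fin N) ℂ :=
  ⟨UN.swapM i₀ i₁ * UN.signM i₀, swapM_mul_signM_mem i₀ i₁ h01⟩

/-- The two group elements. [folklore] -/
def gD (_h01 : i₀ ≠ i₁) : Matrix.specialUnitaryGroup (Fin N) ℂ := ⟨phaseM i₀ i₁, phaseM_mem i₀ i₁⟩

/-- **The commutator `a D a⁻¹ D⁻¹ = diag((d ∘ σ)·d̄)`.** [folklore] -/
theorem comm_eq (h01 : i₀ ≠ i₁) :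
    ((gA i₀ i₁ h01 * gD i₀ i₁ h01 * (gA i₀ i₁ h01)⁻¹ * (gD i₀ i₁ h01)⁻¹ : Matrix.specialUnitaryGroup (Fin N) ℂ) :
        Matrix (Fin N) (Fin N) ℂ) =
      Matrix.diagonal (fun i => phaseV i₀ i₁ (Equiv.swap i₀ i₁ i) * star (phaseV i₀ i₁ i)) := by
  have hco : ((gA i₀ i₁ h01 * gD i₀ i₁ h01 * (gA i₀ i₁ h01)⁻¹ * (gD i₀ i₁ h01)⁻¹ :
      Matrix.specialUnitaryGroup (Fin N) ℂ) : Matrix (Fin N) (Fin N) ℂ) =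
      (UN.swapM i₀ i₁ * UN.signM i₀) * phaseM i₀ i₁ * (UN.swapM i₀ i₁ * UN.signM i₀).conjTranspose *
        (phaseM i₀ i₁).conjTranspose := rfl
  rw [hco, Matrix.conjTranspose_mul, UN.conjTranspose_swapM, UN.conjTranspose_signM, phaseM,
    Matrix.diagonal_conjTranspose]
  -- `X Z D Z X D̄ = X (Z D Z) X D̄ = X D X D̄`
  have hZDZ : UN.signM i₀ * Matrix.diagonal (phaseV i₀ i₁) * UN.signM i₀ = Matrix.diagonal (phaseV i₀ i₁) := by
    rw [UN.signM, Matrix.diagonal_mul_diagonal, Matrix.diagonal_mul_diagonal]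
    congr 1
    funext i
    simp only [UN.signV]
    split_ifs <;> ring
  have hXDX : UN.swapM i₀ i₁ * Matrix.diagonal (phaseV i₀ i₁) * UN.swapM i₀ i₁ =
      Matrix.diagonal (phaseV i₀ i₁ ∘ Equiv.swap i₀ i₁) := by
    unfold UN.swapM
    rw [PEquiv.toMatrix_toPEquiv_mul, PEquiv.mul_toMatrix_toPEquiv, Matrix.submatrix_submatrix, Equiv.symm_swap]
    exact Matrix.submatrix_diagonal_equiv _ _
  calc UN.swapM i₀ i₁ * UN.signM i₀ * Matrix.diagonal (phaseV i₀ i₁) * (UN.signM i₀ * UN.swapM i₀ i₁) *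
        Matrix.diagonal (star (phaseV i₀ i₁))
      = UN.swapM i₀ i₁ * (UN.signM i₀ * Matrix.diagonal (phaseV i₀ i₁) * UN.signM i₀) * UN.swapM i₀ i₁ *
          Matrix.diagonal (star (phaseV i₀ i₁)) := by simp only [Matrix.mul_assoc]
    _ = Matrix.diagonal (phaseV i₀ i₁ ∘ Equiv.swap i₀ i₁) * Matrix.diagonal (star (phaseV i₀ i₁)) := by
          rw [hZDZ, hXDX]
    _ = _ := by rw [Matrix.diagonal_mul_diagonal]; rfl

/-- **The commutator has plaquette action `4`.** [folklore] -/
theorem action_comm (h01 : i₀ ≠ i₁) :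
    (N : ℝ) - (fundamentalRep (Fin N)
      (gA i₀ i₁ h01 * gD i₀ i₁ h01 * (gA i₀ i₁ h01)⁻¹ * (gD i₀ i₁ h01)⁻¹)).trace.re = 4 := by
  rw [fundamentalRep_apply, comm_eq i₀ i₁ h01, Matrix.trace_diagonal]
  have hterm : ∀ i : Fin N, phaseV i₀ i₁ (Equiv.swap i₀ i₁ i) * star (phaseV i₀ i₁ i) =
      1 + ((if i = i₀ then -2 else 0) + (if i = i₁ then -2 else 0)) := by
    intro i
    by_cases hi0 : i = i₀
    · subst hi0
      simp only [phaseV, Equiv.swap_apply_left, if_neg (Ne.symm h01), if_true, if_neg h01]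
      norm_num [Complex.ext_iff]
    · by_cases hi1 : i = i₁
      · subst hi1
        simp only [phaseV, Equiv.swap_apply_right, if_true, if_neg hi0, if_neg h01]
        norm_num [Complex.ext_iff]
      · simp only [phaseV, Equiv.swap_apply_of_ne_of_ne hi0 hi1, if_neg hi0, if_neg hi1]
        simp
  simp_rw [hterm]
  rw [Finset.sum_add_distrib, Finset.sum_add_distrib, Finset.sum_const, Finset.card_univ, Fintype.card_fin,
    Finset.sum_ite_eq' Finset.univ i₀, Finset.sum_ite_eq' Finset.univ i₁]
  simp only [Finset.mem_univ, if_true, nsmul_eq_mul, mul_one]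
  simp
  ring

end Pair

/-! ## §3. The extensive configuration and the instance -/

/-- **(S) for `SU(N)`, `N ≥ 2`, `d ≥ 2`**: some configuration has Wilson action `≥ 4·L^d`. [folklore] -/
theorem exists_action_ge (hN : 2 ≤ N) {d : ℕ} (hd : 2 ≤ d) (L : ℕ) [NeZero L] :
    ∃ V : GaugeConfig d L (Matrix.specialUnitaryGroup (Fin N) ℂ),
      4 * (L : ℝ) ^ d ≤ wilsonAction (fundamentalRep (Fin N)) V := by
  set i₀ : Fin N := ⟨0, by omega⟩ with hi₀
  set i₁ : Fin N := ⟨1, by omega⟩ with hi₁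
  have h01 : i₀ ≠ i₁ := by simp [hi₀, hi₁, Fin.ext_iff]
  set j₀ : Fin d := ⟨0, by omega⟩ with hj₀
  set j₁ : Fin d := ⟨1, by omega⟩ with hj₁
  have hj : j₀ ≠ j₁ := by simp [hj₀, hj₁, Fin.ext_iff]
  have hjlt : j₀ < j₁ := by simp [hj₀, hj₁, Fin.lt_def]
  refine ⟨fun e => if e.2 = j₀ then gA i₀ i₁ h01 else if e.2 = j₁ then gD i₀ i₁ h01 else 1, ?_⟩
  set f : Site d L → {p : Fin d × Fin d // p.1 < p.2} → ℝ := fun x q =>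
    (N : ℝ) - (fundamentalRep (Fin N) (plaquetteHolonomy
      (fun e : Edge d L => if e.2 = j₀ then gA i₀ i₁ h01 else if e.2 = j₁ then gD i₀ i₁ h01 else 1)
        x q.1.1 q.1.2)).trace.re with hf
  have hsum : wilsonAction (fundamentalRep (Fin N))
      (fun e : Edge d L => if e.2 = j₀ then gA i₀ i₁ h01 else if e.2 = j₁ then gD i₀ i₁ h01 else 1) =
        ∑ x : Site d L, ∑ q : {p : Fin d × Fin d // p.1 < p.2}, f x q := by
    unfold wilsonAction
    rw [Fintype.sum_prod_type]
  have hnn : ∀ x q, 0 ≤ f x q := fun x q => sub_nonneg.2 (SUN.re_trace_le N _)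
  have hterm : ∀ x : Site d L, f x ⟨(j₀, j₁), hjlt⟩ = 4 := by
    intro x
    have hhol : plaquetteHolonomy
        (fun e : Edge d L => if e.2 = j₀ then gA i₀ i₁ h01 else if e.2 = j₁ then gD i₀ i₁ h01 else 1) x j₀ j₁ =
          gA i₀ i₁ h01 * gD i₀ i₁ h01 * (gA i₀ i₁ h01)⁻¹ * (gD i₀ i₁ h01)⁻¹ := by
      simp only [plaquetteHolonomy, if_true, if_neg (Ne.symm hj)]
    show (N : ℝ) - (fundamentalRep (Fin N) (plaquetteHolonomy
      (fun e : Edge d L => if e.2 = j₀ then gA i₀ i₁ h01 else if e.2 = j₁ then gD i₀ i₁ h01 else 1)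
        x j₀ j₁)).trace.re = 4
    rw [hhol]
    exact action_comm i₀ i₁ h01
  have hx : ∀ x : Site d L, (4 : ℝ) ≤ ∑ q : {p : Fin d × Fin d // p.1 < p.2}, f x q := by
    intro x
    rw [← hterm x]
    exact Finset.single_le_sum (fun q _ => hnn x q) (Finset.mem_univ _)
  have hV : Fintype.card (Site d L) = L ^ d := by simp [ZMod.card, Fintype.card_fin]
  rw [hsum]
  calc 4 * (L : ℝ) ^ d = ∑ _x : Site d L, (4 : ℝ) := by
        rw [Finset.sum_const, Finset.card_univ, hV, nsmul_eq_mul]; push_cast; ring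
    _ ≤ ∑ x : Site d L, ∑ q : {p : Fin d × Fin d // p.1 < p.2}, f x q := Finset.sum_le_sum fun x _ => hx x

/-- The tree's topological-group instance of `SU(N)`, at the Hilbert–Schmidt metric topology. [folklore] -/
theorem isTopologicalGroup_hs :
    @IsTopologicalGroup (Matrix.specialUnitaryGroup (Fin N) ℂ) (@UniformSpace.toTopologicalSpace _
      (@PseudoMetricSpace.toUniformSpace _ (@MetricSpace.toPseudoMetricSpace
        (Matrix.specialUnitaryGroup (Fin N) ℂ) Subtype.metricSpace))) _ :=
  (inferInstance : IsTopologicalGroup (Matrix.specialUnitaryGroup (Fin N) ℂ))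

/-- Compactness of `SU(N)` at the Hilbert–Schmidt metric topology. [folklore] -/
theorem compactSpace_hs :
    @CompactSpace (Matrix.specialUnitaryGroup (Fin N) ℂ) (@UniformSpace.toTopologicalSpace _
      (@PseudoMetricSpace.toUniformSpace _ (@MetricSpace.toPseudoMetricSpace
        (Matrix.specialUnitaryGroup (Fin N) ℂ) Subtype.metricSpace))) :=
  (inferInstance : CompactSpace (Matrix.specialUnitaryGroup (Fin N) ℂ))

/-- Second countability of `SU(N)` at the Hilbert–Schmidt metric topology. [folklore] -/
theorem secondCountable_hs :
    @SecondCountableTopology (Matrix.specialUnitaryGroup (Fin N) ℂ) (@UniformSpace.toTopologicalSpace _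
      (@PseudoMetricSpace.toUniformSpace _ (@MetricSpace.toPseudoMetricSpace
        (Matrix.specialUnitaryGroup (Fin N) ℂ) Subtype.metricSpace))) :=
  (inferInstance : SecondCountableTopology (Matrix.specialUnitaryGroup (Fin N) ℂ))

/-- The Borel structure of `SU(N)` at the Hilbert–Schmidt metric topology. [folklore] -/
theorem borelSpace_hs :
    @BorelSpace (Matrix.specialUnitaryGroup (Fin N) ℂ) (@UniformSpace.toTopologicalSpace _
      (@PseudoMetricSpace.toUniformSpace _ (@MetricSpace.toPseudoMetricSpace
        (Matrix.specialUnitaryGroup (Fin N) ℂ) Subtype.metricSpace))) _ :=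
  (inferInstance : BorelSpace (Matrix.specialUnitaryGroup (Fin N) ℂ))

/-- **(C2a) for `SU(N)`, `N ≥ 2`, `d ≥ 2`, Hilbert–Schmidt metric** (OURS; closes this instance of the conjecture
item `Conjectures.ExactTransportBiLipschitz`; `SU(3)`, `d = 4` included): `Lip(T)·coLip(T) ≥ e^{cβ}` for every
exact bi-Lipschitz transport `T` of `Haar^{⊗E}` onto the Wilson measure, `β ≥ β₀`, uniformly in `L`. [folklore] -/
theorem exactTransportBiLipschitz (d N : ℕ) (hd : 2 ≤ d) (hN : 2 ≤ N) :
    @Conjectures.ExactTransportBiLipschitz d N (Matrix.specialUnitaryGroup (Fin N) ℂ) _ Subtype.metricSpace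
      isTopologicalGroup_hs compactSpace_hs _ borelSpace_hs (fundamentalRep (Fin N)) := by
  haveI : NeZero N := ⟨by omega⟩
  obtain ⟨a, ha, hlo⟩ := haar_closedBall_ge (N := N)
  obtain ⟨A, hA, hup⟩ := haar_closedBall_le (N := N)
  have hκ : 0 < N * N - 1 := by
    have : 2 * 2 ≤ N * N := Nat.mul_le_mul hN hN
    omega
  exact @exactTransportBiLipschitz_of_ballVolumes N (Matrix.specialUnitaryGroup (Fin N) ℂ) _ Subtype.metricSpace
    isTopologicalGroup_hs compactSpace_hs secondCountable_hs _ borelSpace_hs (fundamentalRep (Fin N)) d (by omega)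
    (continuous_fundamentalRep (Fin N)) (SUN.re_trace_le N) neg_le_re_trace (N * N - 1) hκ a A ha hlo
    (fun g r hr => hup g r hr) 4 (by norm_num) (fun L _ => exists_action_ge hN hd L)

end Summit.Ventures.LatticeQCDFlow.Theory2.Lattice.SUN

end
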